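import Literature.Geometry.Riemannian.HeatFlowNashSmoothing
import Literature.Geometry.Riemannian.HeatKernelDuality
import Literature.Geometry.Riemannian.HeatPropagationSpaceTime
import Literature.Geometry.Riemannian.FundamentalLemmaInequality
import Literature.Geometry.Riemannian.KernelNashEntropy
import Literature.Geometry.Riemannian.NashInequalityRicciFlow
import HarnessLib

/-!
# The `L¹ → L^∞` bound `(P_{s→t}φ)(x) ≤ C (t − s)^{-m/2} ∫ φ dV_s` for the heat propagation of a
# Ricci flow on a closed manifold (Nash's argument, duality)

E. B. Davies, *Heat kernels and spectral theory* (1989), §2.4: the `L¹ → L²` bound for the heat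
flow and the (backward) `L¹ → L²` bound for the adjoint flow compose, by duality, to an
`L¹ → L^∞` bound with the on-diagonal heat kernel rate `(t − s)^{-m/2}`. For a Ricci flow
`(g, cov)` of a `C^∞` family of Riemannian metrics on `[a, T]` on a closed manifold modelled on
`ℝᵐ`, with `|R| ≤ C₀` and Nash's inequality (constants `A ≥ 1`, `B ≥ 0`) at all times of
`[a, T]`, we prove

* `IsRicciFlow.heatValue_le_of_nash` — for `a ≤ s < t ≤ T`, smooth `φ ≥ 0` and every `x`,
  `(P_{s→t}φ)(x) ≤ e^{(2B/A+C₀)(T−a)} (mA/4)^{m/2} e^{2C₀(T−a)} 2^{m/2} (t−s)^{−m/2} ∫ φ dV_{g(s)}`.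

Proof: with `r` the midpoint, `∫ (P_{s→t}φ) ψ dV_t = ∫ (P_{s→r}φ)(y) v_ψ(r, y) dV_r`
(`IsRicciFlow.integral_mul_eq_of_heat_conjugateHeat`, `v_ψ` the conjugate heat solution on
`[r, t]` with `v_ψ(t) = ψ ≥ 0`) `≤ ‖P_{s→r}φ‖₂ ‖v_ψ(r)‖₂`, and both factors are bounded by
`HeatFlowNashSmoothing.lean` (after translating the sub-flows to start at time `0`); the resulting
`∫ (P_{s→t}φ) ψ dV_t ≤ K ∫ ψ dV_t` for all smooth `ψ ≥ 0` gives the pointwise bound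
(`le_of_forall_integral_mul_contMDiff_le`). Everything is proved; no definitions, no named facts.

## References

* E. B. Davies, *Heat kernels and spectral theory*, Cambridge Tracts in Math. 92 (1989), §2.4.
* R. H. Bamler, *Entropy and heat kernel bounds on a Ricci flow background*, arXiv:2008.07093
  (2020), §2.3 (duality). [Bamler2020Entropy]
-/

noncomputable section

open Bundle Set Function Filter Manifold MeasureTheory Measure TopologicalSpace
open scoped Manifold ContDiff Topology ENNReal NNReal

namespace Literature.Geometry.Riemannian

open Lorentzian Lorentzian.PseudoRiemannianMetric

section UpperBound

variable {m : ℕ} {H : Type*} [TopologicalSpace H]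
  {I : ModelWithCorners ℝ (EuclideanSpace ℝ (Fin m)) H} [I.Boundaryless]
  {M : Type*} [TopologicalSpace M] [ChartedSpace H M] [IsManifold I ∞ M]
  [T2Space M] [CompactSpace M] [SecondCountableTopology M] [MeasurableSpace M] [BorelSpace M]
  {g : ℝ → PseudoRiemannianMetric I ∞ (EuclideanSpace ℝ (Fin m)) (TangentSpace I : M → Type _)}
  {cov : ℝ → CovariantDerivative I (EuclideanSpace ℝ (Fin m)) (TangentSpace I : M → Type _)}
  (hh : IsContMDiffFamilyOn ∞ g univ) (hR' : ∀ r, (g r).IsRiemannian)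

omit [I.Boundaryless] [SecondCountableTopology M] [T2Space M] in
/-- Cauchy–Schwarz for continuous functions on a closed manifold with a finite measure:
`∫ f g ≤ (∫ f²)^{1/2} (∫ g²)^{1/2}` for `f, g ≥ 0` continuous. [folklore] -/
theorem integral_mul_le_sqrt_mul_sqrt (μ : Measure M) [IsFiniteMeasure μ] {f₁ f₂ : M → ℝ}
    (hf₁ : Continuous f₁) (hf₂ : Continuous f₂) (h₁ : ∀ x, 0 ≤ f₁ x) (h₂ : ∀ x, 0 ≤ f₂ x) :
    ∫ x, f₁ x * f₂ x ∂μ ≤ (∫ x, f₁ x ^ 2 ∂μ) ^ (1 / (2 : ℝ)) * (∫ x, f₂ x ^ 2 ∂μ) ^ (1 / (2 : ℝ)) := by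
  have hmem : ∀ {f : M → ℝ}, Continuous f → MemLp f (ENNReal.ofReal 2) μ := by
    intro f hf
    obtain ⟨C, hC⟩ := isCompact_univ.exists_bound_of_continuousOn hf.continuousOn
    exact MemLp.of_bound hf.aestronglyMeasurable C (Eventually.of_forall fun x ↦ hC x (mem_univ x))
  have key := integral_mul_le_Lp_mul_Lq_of_nonneg Real.HolderConjugate.two_two
    (Eventually.of_forall h₁) (Eventually.of_forall h₂) (hmem hf₁) (hmem hf₂) (μ := μ)
  simpa only [Real.rpow_two] using key

include hh hR' in
/-- **`L¹ → L^∞` bound for the heat propagation of a Ricci flow** (Nash's argument and duality).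
Let `(g, cov)` be a Ricci flow on `[a, T]` of a `C^∞` family of Riemannian metrics on a closed
manifold modelled on `ℝᵐ`, `m ≥ 1`, with `|R| ≤ C₀` on `M × [a, T]` and Nash's inequality with
constants `A ≥ 1`, `B ≥ 0` at every time of `[a, T]`. Then for `a ≤ s < t ≤ T`, smooth `φ ≥ 0`
and every `x ∈ M`,
`(P_{s→t}φ)(x) ≤ e^{(2B/A+C₀)(T−a)} (mA/4)^{m/2} e^{2C₀(T−a)} 2^{m/2} (t−s)^{−m/2} ∫ φ dV_{g(s)}`.
[cite: Bamler2020Entropy, §2.3] -/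
theorem IsRicciFlow.heatValue_le_of_nash {a T : ℝ} (hflow : IsRicciFlow g cov (Icc a T))
    (hm : 0 < m) {C₀ : ℝ} (hC₀ : 0 ≤ C₀)
    (hRC₀ : ∀ r ∈ Icc a T, ∀ x, |(g r).scalarCurvatureWith (cov r) x| ≤ C₀)
    {A B : ℝ} (hA : 1 ≤ A) (hB : 0 ≤ B)
    (hNash : ∀ r ∈ Icc a T, ∀ w : M → ℝ, ContMDiff I 𝓘(ℝ, ℝ) ∞ w →
      (∫ x, w x ^ 2 ∂(g r).riemVolume) ^ (1 + 2 / (m : ℝ)) ≤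
        (∫ x, |w x| ∂(g r).riemVolume) ^ (4 / (m : ℝ)) *
          (A * ∫ x, (g r).gradSq w x ∂(g r).riemVolume + B * ∫ x, w x ^ 2 ∂(g r).riemVolume))
    {s t : ℝ} (has : a ≤ s) (hst : s < t) (htT : t ≤ T) {φ : M → ℝ}
    (hφ : ContMDiff I 𝓘(ℝ, ℝ) ∞ φ) (hφ0 : ∀ y, 0 ≤ φ y) (x : M) :
    heatValue g s t x φ ≤
      Real.exp ((2 * B / A + C₀) * (T - a)) * (((m : ℝ) * A / 4) ^ ((m : ℝ) / 2)) *
        Real.exp (2 * C₀ * (T - a)) * (2 : ℝ) ^ ((m : ℝ) / 2) * (t - s) ^ (-((m : ℝ) / 2)) *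
        ∫ y, φ y ∂(g s).riemVolume := by
  haveI : ∀ r, IsFiniteMeasure (g r).riemVolume := fun r ↦ ⟨(g r).riemVolume_univ_lt_top⟩
  haveI : ∀ r, (g r).riemVolume.IsOpenPosMeasure := fun r ↦ by
    rw [riemVolume_eq (hR' r)]; exact isOpenPosMeasure_riemannianMeasure _
  have hmR : (0 : ℝ) < m := by exact_mod_cast hm
  have hA0 : 0 < A := one_pos.trans_le hA
  -- times
  set τ : ℝ := t - s with hτ
  have hτ0 : 0 < τ := sub_pos.2 hst
  set r : ℝ := τ / 2 + s with hr
  have hsr : s < r := by rw [hr]; linarith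
  have hrt : r < t := by rw [hr, hτ]; linarith
  have htr : t - r = τ / 2 := by rw [hr, hτ]; ring
  have hτTa : τ ≤ T - a := by rw [hτ]; linarith
  -- the heat propagation `u` of `φ` from time `s`, a heat solution on `[s, t]`, `u ≥ 0`, `u s = φ`
  set u : ℝ → M → ℝ := fun r' y ↦ heatValue g s r' y φ with hu
  have hus : IsHeatSolutionOn g u s t := isHeatSolutionOn_heatValue hh hR' hst hφ
  have hu0 : ∀ r' y, 0 ≤ u r' y := fun r' y ↦ by
    have h1 := heatValue_mono hh hR' (s := s) (t := r') y contMDiff_const hφ hφ0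
    rwa [heatValue_const hR'] at h1
  have hu_s : u s = φ := funext fun y ↦ heatValue_of_le le_rfl y φ
  set m₀ : ℝ := ∫ y, φ y ∂(g s).riemVolume with hm₀
  have hm₀0 : 0 ≤ m₀ := integral_nonneg hφ0
  -- (1) the `L²` bound for `u` at time `r`, via the translated flow on `[0, τ]`
  set C₁ : ℝ := 2 * B / A + C₀ with hC₁
  have hC₁0 : 0 ≤ C₁ := by positivity
  set P : ℝ := Real.exp (C₁ * (T - a)) * (((m : ℝ) * A / 4) ^ ((m : ℝ) / 2)) *
    Real.exp (2 * C₀ * (T - a)) * (τ / 2) ^ (-((m : ℝ) / 2)) with hP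
  have hP0 : 0 ≤ P := by positivity
  have hEu : ∫ y, u r y ^ 2 ∂(g r).riemVolume ≤ P * m₀ ^ 2 := by
    have hflow₁ : IsRicciFlow (fun r' ↦ g (r' + s)) (fun r' ↦ cov (r' + s)) (Icc 0 τ) := by
      refine (hflow.comp_add_const s).mono fun r' hr' ↦ ?_
      exact ⟨by linarith [hr'.1], by rw [hτ] at hr'; linarith [hr'.2]⟩
    have hw₁ : IsHeatSolutionOn (fun r' ↦ g (r' + s)) (fun r' ↦ u (r' + s)) 0 τ := by
      simpa only [sub_self, hτ] using hus.comp_add_const s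
    have hmem : ∀ r' ∈ Icc 0 τ, r' + s ∈ Icc a T := fun r' hr' ↦
      ⟨by linarith [hr'.1], by rw [hτ] at hr'; linarith [hr'.2]⟩
    have key := hflow₁.integral_sq_heat_le hτ0 (fun r' ↦ hR' _) hm hC₀
      (fun r' hr' y ↦ hRC₀ _ (hmem r' hr') y) hA hB (fun r' hr' w hw ↦ hNash _ (hmem r' hr') w hw)
      hw₁ (fun r' _ y ↦ hu0 _ y) (t := τ / 2) ⟨by linarith, by linarith⟩
    simp only [zero_add, hu_s] at key
    refine key.trans ?_
    have h1 : Real.exp ((2 * B / A + C₀) * τ) ≤ Real.exp (C₁ * (T - a)) :=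
      Real.exp_le_exp.2 (by rw [hC₁]; exact mul_le_mul_of_nonneg_left hτTa hC₁0)
    have h2 : Real.exp (2 * C₀ * τ) ≤ Real.exp (2 * C₀ * (T - a)) :=
      Real.exp_le_exp.2 (mul_le_mul_of_nonneg_left hτTa (by positivity))
    rw [hP]
    gcongr
  -- (2)+(3) duality: `∫ u(t) ψ dV_t ≤ P m₀ ∫ ψ dV_t` for smooth `ψ ≥ 0`
  have hdual : ∀ ψ : M → ℝ, ContMDiff I 𝓘(ℝ, ℝ) ∞ ψ → (∀ y, 0 ≤ ψ y) →
      ∫ y, u t y * ψ y ∂(g t).riemVolume ≤ P * m₀ * ∫ y, ψ y ∂(g t).riemVolume := by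
    intro ψ hψ hψ0
    set Mψ : ℝ := ∫ y, ψ y ∂(g t).riemVolume with hMψ
    have hMψ0 : 0 ≤ Mψ := integral_nonneg hψ0
    -- the conjugate heat solution on `[r, t]` with final value `ψ`
    have hflow₂ : IsRicciFlow g cov (Icc r t) := hflow.mono (Icc_subset_Icc (has.trans hsr.le) htT)
    obtain ⟨v, hvt, hv, hv0⟩ := hflow₂.exists_isConjugateHeatSolutionOn_Icc' hrt (fun r' _ ↦ hR' r') hψ
    have hv0' := hv0 hψ0
    -- its `L²` bound at time `r`, via the translated flow on `[0, τ/2]`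
    have hEv : ∫ y, v r y ^ 2 ∂(g r).riemVolume ≤ P * Mψ ^ 2 := by
      have hτ2 : 0 < τ / 2 := by positivity
      have hflow₃ : IsRicciFlow (fun r' ↦ g (r' + r)) (fun r' ↦ cov (r' + r)) (Icc 0 (τ / 2)) := by
        refine (hflow.comp_add_const r).mono fun r' hr' ↦ ?_
        exact ⟨by linarith [hr'.1], by linarith [hr'.2]⟩
      have hv₃ : IsConjugateHeatSolutionOn (fun r' ↦ g (r' + r)) (fun r' ↦ cov (r' + r))
          (Icc 0 (τ / 2)) (fun r' ↦ v (r' + r)) := by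
        simpa only [sub_self, htr] using hv.comp_add_const hrt r
      have hmem : ∀ r' ∈ Icc 0 (τ / 2), r' + r ∈ Icc a T := fun r' hr' ↦
        ⟨by linarith [hr'.1], by linarith [hr'.2]⟩
      have key := hflow₃.integral_sq_conjugateHeat_le hτ2 (fun r' ↦ hR' _) hm hC₀
        (fun r' hr' y ↦ hRC₀ _ (hmem r' hr') y) hA hB
        (fun r' hr' w hw ↦ hNash _ (hmem r' hr') w hw) hv₃
        (fun r' hr' y ↦ hv0' _ ⟨by linarith [hr'.1], by linarith [hr'.2]⟩ y) (s := 0)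
        ⟨le_rfl, hτ2⟩
      have e1 : τ / 2 + r = t := by rw [hr, hτ]; ring
      simp only [zero_add, sub_zero, e1, hvt] at key
      refine key.trans ?_
      have h1 : Real.exp ((2 * B / A + C₀) * (τ / 2)) ≤ Real.exp (C₁ * (T - a)) :=
        Real.exp_le_exp.2 (by rw [hC₁]; exact mul_le_mul_of_nonneg_left (by linarith) hC₁0)
      have h2 : (1 : ℝ) ≤ Real.exp (2 * C₀ * (T - a)) := Real.one_le_exp (by nlinarith [hτ0, hτTa])
      rw [hP]
      calc Real.exp ((2 * B / A + C₀) * (τ / 2)) * ((m : ℝ) * A / 4) ^ ((m : ℝ) / 2) *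
            (τ / 2) ^ (-((m : ℝ) / 2)) * Mψ ^ 2
          = Real.exp ((2 * B / A + C₀) * (τ / 2)) * ((m : ℝ) * A / 4) ^ ((m : ℝ) / 2) * 1 *
            (τ / 2) ^ (-((m : ℝ) / 2)) * Mψ ^ 2 := by ring
        _ ≤ Real.exp (C₁ * (T - a)) * ((m : ℝ) * A / 4) ^ ((m : ℝ) / 2) *
            Real.exp (2 * C₀ * (T - a)) * (τ / 2) ^ (-((m : ℝ) / 2)) * Mψ ^ 2 := by gcongr
    -- pairing on `[r, t]` and Cauchy–Schwarz
    have hpair := hflow₂.integral_mul_eq_of_heat_conjugateHeat hrt (fun r' _ ↦ hR' r')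
      (hus.mono hsr.le le_rfl) hv
    rw [hvt] at hpair
    rw [hpair]
    have hur : Continuous (u r) := (hus.contMDiff_slice ⟨hsr.le, hrt.le⟩).continuous
    have hvr : Continuous (v r) := (contMDiff_slice_of_contMDiffOn hv.1 ⟨le_rfl, hrt.le⟩).continuous
    have hCS := integral_mul_le_sqrt_mul_sqrt (g r).riemVolume hur hvr (hu0 r)
      (hv0' r ⟨le_rfl, hrt.le⟩)
    refine hCS.trans ?_
    have h1 : (∫ y, u r y ^ 2 ∂(g r).riemVolume) ^ (1 / (2 : ℝ)) ≤ (P * m₀ ^ 2) ^ (1 / (2 : ℝ)) :=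
      Real.rpow_le_rpow (integral_nonneg fun y ↦ sq_nonneg _) hEu (by norm_num)
    have h2 : (∫ y, v r y ^ 2 ∂(g r).riemVolume) ^ (1 / (2 : ℝ)) ≤ (P * Mψ ^ 2) ^ (1 / (2 : ℝ)) :=
      Real.rpow_le_rpow (integral_nonneg fun y ↦ sq_nonneg _) hEv (by norm_num)
    have h3 : (P * m₀ ^ 2) ^ (1 / (2 : ℝ)) * (P * Mψ ^ 2) ^ (1 / (2 : ℝ)) = P * m₀ * Mψ := by
      rw [← Real.mul_rpow (by positivity) (by positivity),
        show P * m₀ ^ 2 * (P * Mψ ^ 2) = (P * m₀ * Mψ) ^ 2 by ring,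
        ← Real.sqrt_eq_rpow, Real.sqrt_sq (by positivity)]
    calc _ ≤ (P * m₀ ^ 2) ^ (1 / (2 : ℝ)) * (P * Mψ ^ 2) ^ (1 / (2 : ℝ)) :=
          mul_le_mul h1 h2 (Real.rpow_nonneg (integral_nonneg fun y ↦ sq_nonneg _) _)
            (Real.rpow_nonneg (by positivity) _)
      _ = P * m₀ * Mψ := h3
  -- (4) the pointwise bound by the fundamental lemma
  have hut : Continuous (u t) := (hus.contMDiff_slice ⟨hst.le, le_rfl⟩).continuous
  have hle := le_of_forall_integral_mul_contMDiff_le (J := I) ((g t).riemVolume) isOpen_univ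
    hut.continuousOn (K := P * m₀) (fun ζ hζ _ _ hζ0 ↦ hdual ζ hζ hζ0) x (mem_univ x)
  -- rewrite the constant `P m₀`
  have hP' : P = Real.exp (C₁ * (T - a)) * (((m : ℝ) * A / 4) ^ ((m : ℝ) / 2)) *
      Real.exp (2 * C₀ * (T - a)) * (2 : ℝ) ^ ((m : ℝ) / 2) * τ ^ (-((m : ℝ) / 2)) := by
    rw [hP]
    have : (τ / 2) ^ (-((m : ℝ) / 2)) = (2 : ℝ) ^ ((m : ℝ) / 2) * τ ^ (-((m : ℝ) / 2)) := by
      rw [Real.div_rpow hτ0.le (by norm_num), Real.rpow_neg (by norm_num : (0 : ℝ) ≤ 2),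
        div_inv_eq_mul, mul_comm]
    rw [this]; ring
  show u t x ≤ _
  rw [hP', hC₁] at hle
  exact hle


include hh hR' in
/-- **On-diagonal rate for the heat propagation of a Ricci flow**: for a Ricci flow on `[a, T]`,
`a < T`, of a `C^∞` family of Riemannian metrics on a closed manifold modelled on `ℝᵐ`, `m ≥ 3`,
there is `C ≥ 0` with `(P_{s→t}φ)(x) ≤ C (t − s)^{−m/2} ∫ φ dV_{g(s)}` for all `a ≤ s < t ≤ T`,
smooth `φ ≥ 0` and `x ∈ M` (`heatValue_le_of_nash` with the curvature bound of the compact flow and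
the uniform Nash constants `IsRicciFlow.exists_uniform_nash_const`). [cite: Bamler2020Entropy, §2.3] -/
theorem IsRicciFlow.exists_heatValue_le {a T : ℝ} (haT : a < T) (hflow : IsRicciFlow g cov (Icc a T))
    (hm : 3 ≤ m) :
    ∃ C : ℝ, 0 ≤ C ∧ ∀ s t : ℝ, a ≤ s → s < t → t ≤ T → ∀ φ : M → ℝ,
      ContMDiff I 𝓘(ℝ, ℝ) ∞ φ → (∀ y, 0 ≤ φ y) → ∀ x : M,
        heatValue g s t x φ ≤ C * (t - s) ^ (-((m : ℝ) / 2)) * ∫ y, φ y ∂(g s).riemVolume := by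
  set T₁ : ℝ := T - a with hT₁
  have hT₁0 : 0 < T₁ := sub_pos.2 haT
  have hflow₁ : IsRicciFlow (fun r ↦ g (r + a)) (fun r ↦ cov (r + a)) (Icc 0 T₁) := by
    refine (hflow.comp_add_const a).mono fun r hr ↦ ?_
    exact ⟨by linarith [hr.1], by rw [hT₁] at hr; linarith [hr.2]⟩
  have hmem : ∀ r ∈ Icc a T, r - a ∈ Icc 0 T₁ := fun r hr ↦
    ⟨by linarith [hr.1], by rw [hT₁]; linarith [hr.2]⟩
  obtain ⟨C₀, hC₀, hRC₀'⟩ := hflow₁.exists_abs_scalarCurvatureWith_le hT₁0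
  have hRC₀ : ∀ r ∈ Icc a T, ∀ x, |(g r).scalarCurvatureWith (cov r) x| ≤ C₀ := fun r hr x ↦ by
    simpa using hRC₀' (r - a) (hmem r hr) x
  obtain ⟨A, B, hA, hB, hNash'⟩ := hflow₁.exists_uniform_nash_const hT₁0 (fun r _ ↦ hR' _)
    hm
  have hNash : ∀ r ∈ Icc a T, ∀ w : M → ℝ, ContMDiff I 𝓘(ℝ, ℝ) ∞ w →
      (∫ x, w x ^ 2 ∂(g r).riemVolume) ^ (1 + 2 / (m : ℝ)) ≤
        (∫ x, |w x| ∂(g r).riemVolume) ^ (4 / (m : ℝ)) *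
          (A * ∫ x, (g r).gradSq w x ∂(g r).riemVolume + B * ∫ x, w x ^ 2 ∂(g r).riemVolume) :=
    fun r hr w hw ↦ by simpa using hNash' (r - a) (hmem r hr) w hw
  have hm0 : 0 < m := by omega
  refine ⟨Real.exp ((2 * B / A + C₀) * (T - a)) * (((m : ℝ) * A / 4) ^ ((m : ℝ) / 2)) *
      Real.exp (2 * C₀ * (T - a)) * (2 : ℝ) ^ ((m : ℝ) / 2), by
        have : 0 < A := one_pos.trans_le hA
        positivity,
    fun s t has hst htT φ hφ hφ0 x ↦ ?_⟩
  exact hflow.heatValue_le_of_nash hh hR' hm0 hC₀ hRC₀ hA hB hNash has hst htT hφ hφ0 x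

end UpperBound

end Literature.Geometry.Riemannian

end
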